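import Literature.NumberTheory.LFunctions.MertensErrorTermsMeanValueRHPiLiWindow
import HarnessLib

/-!
# RH-CONDITIONAL literature, proof layer — «nothing here bears on the truth of RH»
# Zhao 2025, Corollary 1 for `i = 3` PROVED, and the named fact `Zhao2025MertensMean_cor1` DISCHARGED

Proof companion of `MertensErrorTermsMeanValueRH.lean` (T. Zhao, Res. Number Theory 11 (2025) 62 =
arXiv:2411.18903 [bib: `Zhao2025MertensMean`]); theorems only, no definition, no new named fact. The source's Corollary 1
(RH-CONDITIONAL): «Assuming RH, for each `i ∈ {1, 2, 3}` and any positive constant `c < ((2−B₁)/(2+B₁))²` we have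
`∫_{cX}^X E_i(x) dx > 0` for `X ≥ X₀(c)`», `B₁ = 2 + γ − log 4π`. Cases `i = 1, 2` are the tree's
`Zhao2025.cor1_E₁_of_RH` (`MertensErrorTermsMeanValueRHWindow.lean`) and `Zhao2025.cor1_E₂_of_RH`
(`MertensErrorTermsMeanValueRHPiLiWindow.lean`). This file PROVES `i = 3` and assembles

  **`Zhao2025MertensMean_cor1_holds : Zhao2025MertensMean_cor1`**.

Route for `i = 3` (§4 of the source opens with `∫₂^X E₃ = e^γ ∫₂^X (e^{E₂(x)} − 1) dx`; read exactly, Mertens' product is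
`(log x)⁻¹ ∏_{p≤x} (1 − 1/p)⁻¹ = e^γ · exp(E₂(x) − δ(x))` with the non-negative tail
`δ(x) = Σ_{p > x} (−log(1 − 1/p) − 1/p) ≤ 1/⌊x⌋` that the source's display absorbs — immaterial for the eventual
statement): `E₃ = e^γ(exp(E₂ − δ) − 1) ≥ e^γ(E₂ − δ) ≥ e^γ(E₂ − 2/x)` (`eˣ ≥ 1 + x`), so
`∫_{cX}^X E₃ ≥ e^γ(∫_{cX}^X E₂ − 2 log(1/c)) ≥ e^γ(κ√X/log X − 2 log(1/c)) > 0` for large `X` by the quantitative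
`i = 2` window `Zhao2025.exists_eventually_le_integral_window_E₂_of_RH`. (The source's own §4 argument runs through the
second moment of `E₂` and `|E₂| < 1`; the first-order inequality suffices for Corollary 1.)

* `Zhao2025.mertensLog_eq_E₂_sub_tail` — `Σ_{p≤x} −log(1 − 1/p) = E₂(x) + log log x + γ − δ(x)`;
* `Zhao2025.E₃_eq_exp` — `E₃(x) = e^γ (exp(E₂(x) − δ(x)) − 1)` (`x > 1`); `Zhao2025.primeLogTail_le` — `0 ≤ δ(x) ≤ 1/⌊x⌋`;
* `Zhao2025.E₃_ge` — `E₃(x) ≥ e^γ (E₂(x) − 2/x)` (`x ≥ 2`);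
* `Zhao2025.cor1_E₃_of_RH`, `Zhao2025MertensMean_cor1_holds`.
-/

noncomputable section

open Filter Topology Set MeasureTheory Finset
open scoped Real Chebyshev

namespace Literature.NumberTheory.LFunctions

namespace Zhao2025

/-! ### The tail `δ(x) = Σ_{k > ⌊x⌋} d_k`, `d_k = −log(1 − 1/k) − 1/k` at primes -/

/-- `d_k = −log(1 − 1/k) − 1/k` (primes; `0` otherwise) is non-negative. [cite: Zhao2025MertensMean, §1.1 (definition of ℰ₂)] -/
theorem primeLogCoeffSubInv_nonneg (k : ℕ) : 0 ≤ Mertens.primeLogCoeffSubInv k := by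
  unfold Mertens.primeLogCoeffSubInv
  split_ifs with hk
  · have h := Nicolas.inv_le_primeLogCoeff hk
    rw [Nicolas.primeLogCoeff_of_prime hk] at h
    linarith
  · exact le_rfl

/-- `d_k ≤ 1/(k−1) − 1/k` for `k ≥ 2` (`−log(1 − 1/p) ≤ 1/(p − 1)`); the telescoping majorant of the tail.
[cite: Zhao2025MertensMean, §1.1 (definition of ℰ₂)] -/
theorem primeLogCoeffSubInv_le {k : ℕ} (hk : 2 ≤ k) :
    Mertens.primeLogCoeffSubInv k ≤ ((k : ℝ) - 1)⁻¹ - (k : ℝ)⁻¹ := by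
  have hk2 : (2 : ℝ) ≤ k := by exact_mod_cast hk
  unfold Mertens.primeLogCoeffSubInv
  split_ifs with hp
  · have h := Nicolas.primeLogCoeff_le_inv_sub_one hp
    rw [Nicolas.primeLogCoeff_of_prime hp] at h
    linarith
  · have : (k : ℝ)⁻¹ ≤ ((k : ℝ) - 1)⁻¹ := inv_anti₀ (by linarith) (by linarith)
    linarith

/-- **`0 ≤ δ(x)`**, `δ(x) = Σ_{k > ⌊x⌋} d_k` (written `Σ' i, d_{i + ⌊x⌋ + 1}`). [cite: Zhao2025MertensMean, §4 (first display)] -/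
theorem primeLogTail_nonneg (x : ℝ) : 0 ≤ ∑' i : ℕ, Mertens.primeLogCoeffSubInv (i + (⌊x⌋₊ + 1)) :=
  tsum_nonneg fun _ => primeLogCoeffSubInv_nonneg _

/-- **`δ(x) ≤ 1/⌊x⌋`** for `x ≥ 1` (telescoping `d_k ≤ 1/(k−1) − 1/k`). [cite: Zhao2025MertensMean, §4 (first display)] -/
theorem primeLogTail_le {x : ℝ} (hx : 1 ≤ x) :
    ∑' i : ℕ, Mertens.primeLogCoeffSubInv (i + (⌊x⌋₊ + 1)) ≤ (⌊x⌋₊ : ℝ)⁻¹ := by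
  set N : ℕ := ⌊x⌋₊ with hN
  have hN1 : 1 ≤ N := by rw [hN]; exact Nat.one_le_floor_iff _ |>.2 hx  -- `⌊x⌋ ≥ 1`
  have hN0 : (0 : ℝ) < N := by exact_mod_cast hN1
  refine Real.tsum_le_of_sum_range_le (fun i => primeLogCoeffSubInv_nonneg _) fun n => ?_
  -- `Σ_{i<n} d_{i+N+1} ≤ Σ_{i<n} (1/(i+N) − 1/(i+N+1)) = 1/N − 1/(n+N) ≤ 1/N`
  have hle : ∑ i ∈ range n, Mertens.primeLogCoeffSubInv (i + (N + 1)) ≤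
      ∑ i ∈ range n, ((((i : ℕ) : ℝ) + N)⁻¹ - (((i + 1 : ℕ) : ℝ) + N)⁻¹) := by
    refine sum_le_sum fun i _ => ?_
    have h := primeLogCoeffSubInv_le (k := i + (N + 1)) (by omega)
    refine h.trans (le_of_eq ?_)
    push_cast
    ring_nf
  refine hle.trans ?_
  rw [Finset.sum_range_sub' (fun i : ℕ => (((i : ℕ) : ℝ) + N)⁻¹) n]
  have : 0 ≤ (((n : ℕ) : ℝ) + N)⁻¹ := by positivity
  simp only [Nat.cast_zero, zero_add]
  linarith

/-- `δ(x) ≤ 2/x` for `x ≥ 2` (`⌊x⌋ ≥ x/2`). [cite: Zhao2025MertensMean, §4 (first display)] -/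
theorem primeLogTail_le_two_div {x : ℝ} (hx : 2 ≤ x) :
    ∑' i : ℕ, Mertens.primeLogCoeffSubInv (i + (⌊x⌋₊ + 1)) ≤ 2 / x := by
  have hx0 : 0 < x := by linarith
  have hfl : x / 2 ≤ (⌊x⌋₊ : ℝ) := by
    have := Nat.lt_floor_add_one x
    linarith
  refine (primeLogTail_le (by linarith)).trans ?_
  rw [inv_eq_one_div, div_le_div_iff₀ (by linarith) hx0]
  linarith

/-! ### `E₃ = e^γ (exp(E₂ − δ) − 1)` -/

/-- **Mertens' logarithmic sum through `E₂`**: `Σ_{p≤x} −log(1 − 1/p) = E₂(x) + log log x + γ − δ(x)`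
(`ℰ₂ = γ − Σ_k d_k`, `Σ_{p≤x}(−log(1−1/p) − 1/p) = Σ_{k≤⌊x⌋} d_k`). [cite: Zhao2025MertensMean, §4 (first display)] -/
theorem mertensLog_eq_E₂_sub_tail (x : ℝ) :
    Nicolas.mertensLog x = E₂ x + Real.log (Real.log x) + Real.eulerMascheroniConstant -
      ∑' i : ℕ, Mertens.primeLogCoeffSubInv (i + (⌊x⌋₊ + 1)) := by
  have h1 := Mertens.mertensLog_sub_primeRecipSum x
  have h2 := Mertens.summable_primeLogCoeffSubInv.sum_add_tsum_nat_add (⌊x⌋₊ + 1)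
  have h3 : Mertens.meisselMertens = Real.eulerMascheroniConstant - ∑' k, Mertens.primeLogCoeffSubInv k := by
    rw [Mertens.meisselMertens, Mertens.tsum_primeLogCoeffSubInv]; ring
  have h4 : E₂ x = Mertens.primeRecipSum x - Real.log (Real.log x) - Mertens.meisselMertens := rfl
  linarith

/-- **`E₃(x) = e^γ (exp(E₂(x) − δ(x)) − 1)`** for `x > 1` (`∏_{p≤x}(1 − 1/p)⁻¹ = exp Σ_{p≤x} −log(1 − 1/p)` and the previous
identity; the source's `∫₂^X E₃ = e^γ ∫₂^X (e^{E₂} − 1)` with the tail `δ` made explicit). [cite: Zhao2025MertensMean, §4 (first display)] -/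
theorem E₃_eq_exp {x : ℝ} (hx : 1 < x) :
    E₃ x = Real.exp Real.eulerMascheroniConstant *
      (Real.exp (E₂ x - ∑' i : ℕ, Mertens.primeLogCoeffSubInv (i + (⌊x⌋₊ + 1))) - 1) := by
  have hlog : 0 < Real.log x := Real.log_pos hx
  have hprod : (∏ p ∈ Nat.primesLE ⌊x⌋₊, (1 - (p : ℝ)⁻¹)⁻¹) = Real.exp (Nicolas.mertensLog x) := by
    rw [Nicolas.mertensLog_eq_natCast_floor, Nicolas.exp_mertensLog_natCast]
  unfold E₃
  rw [hprod, mertensLog_eq_E₂_sub_tail x,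
    show E₂ x + Real.log (Real.log x) + Real.eulerMascheroniConstant -
        ∑' i : ℕ, Mertens.primeLogCoeffSubInv (i + (⌊x⌋₊ + 1)) =
      (E₂ x - ∑' i : ℕ, Mertens.primeLogCoeffSubInv (i + (⌊x⌋₊ + 1))) + Real.eulerMascheroniConstant +
        Real.log (Real.log x) by ring,
    Real.exp_add, Real.exp_add, Real.exp_log hlog]
  field_simp

/-- **`E₃(x) ≥ e^γ (E₂(x) − 2/x)`** for `x ≥ 2` (`eᵘ ≥ 1 + u` and `δ(x) ≤ 2/x`). [cite: Zhao2025MertensMean, §4 (first display)] -/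
theorem E₃_ge {x : ℝ} (hx : 2 ≤ x) :
    Real.exp Real.eulerMascheroniConstant * (E₂ x - 2 / x) ≤ E₃ x := by
  rw [E₃_eq_exp (by linarith)]
  refine mul_le_mul_of_nonneg_left ?_ (Real.exp_pos _).le
  have h1 := Real.add_one_le_exp (E₂ x - ∑' i : ℕ, Mertens.primeLogCoeffSubInv (i + (⌊x⌋₊ + 1)))
  have h2 := primeLogTail_le_two_div hx
  linarith

/-! ### `E₃` on intervals -/

/-- `E₃` is measurable (the product depends on `⌊x⌋` only). [cite: Zhao2025MertensMean, §1.1 (definition of E₃)] -/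
theorem measurable_E₃ : Measurable E₃ := by
  have h : Measurable fun x : ℝ => ∏ p ∈ Nat.primesLE ⌊x⌋₊, (1 - (p : ℝ)⁻¹)⁻¹ := by
    have : (fun x : ℝ => ∏ p ∈ Nat.primesLE ⌊x⌋₊, (1 - (p : ℝ)⁻¹)⁻¹) =
        (fun n : ℕ => ∏ p ∈ Nat.primesLE n, (1 - (p : ℝ)⁻¹)⁻¹) ∘ Nat.floor := by
      funext t; rfl
    rw [this]
    exact (measurable_from_nat (f := fun n : ℕ => ∏ p ∈ Nat.primesLE n, (1 - (p : ℝ)⁻¹)⁻¹)).comp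
      Nat.measurable_floor
  have : E₃ = fun x => (∏ p ∈ Nat.primesLE ⌊x⌋₊, (1 - (p : ℝ)⁻¹)⁻¹) / Real.log x -
      Real.exp Real.eulerMascheroniConstant := by
    funext x; rfl
  rw [this]
  exact (h.div Real.measurable_log).sub measurable_const

/-- `|E₃(x)| ≤ e^γ (exp(8/log 2) + 1)` for `x ≥ 2` (`|E₂| ≤ 8/log 2`, `0 ≤ δ`). [cite: Zhao2025MertensMean, §1.1 («E₃(x) = O(1/log x)»)] -/
theorem abs_E₃_le {x : ℝ} (hx : 2 ≤ x) :
    |E₃ x| ≤ Real.exp Real.eulerMascheroniConstant * (Real.exp (8 / Real.log 2) + 1) := by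
  rw [E₃_eq_exp (by linarith), abs_mul, abs_of_pos (Real.exp_pos _)]
  refine mul_le_mul_of_nonneg_left ?_ (Real.exp_pos _).le
  have hE := abs_E₂_le hx
  have hδ := primeLogTail_nonneg x
  have hup : Real.exp (E₂ x - ∑' i : ℕ, Mertens.primeLogCoeffSubInv (i + (⌊x⌋₊ + 1))) ≤
      Real.exp (8 / Real.log 2) :=
    Real.exp_le_exp.2 (by linarith [(abs_le.1 hE).2])
  have hpos := Real.exp_pos (E₂ x - ∑' i : ℕ, Mertens.primeLogCoeffSubInv (i + (⌊x⌋₊ + 1)))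
  rw [abs_le]
  constructor <;> linarith

/-- `E₃` is integrable on every `[a, b] ⊂ [2, ∞)`. [cite: Zhao2025MertensMean, §1.1 (definition of E₃)] -/
theorem intervalIntegrable_E₃ {a b : ℝ} (ha : 2 ≤ a) (hab : a ≤ b) : IntervalIntegrable E₃ volume a b := by
  rw [intervalIntegrable_iff_integrableOn_Ioc_of_le hab]
  refine Measure.integrableOn_of_bounded (M := Real.exp Real.eulerMascheroniConstant * (Real.exp (8 / Real.log 2) + 1))
    measure_Ioc_lt_top.ne measurable_E₃.aestronglyMeasurable ?_
  rw [ae_restrict_iff' measurableSet_Ioc]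
  refine Eventually.of_forall fun x hx => ?_
  rw [Real.norm_eq_abs]
  exact abs_E₃_le (ha.trans hx.1.le)

/-- **`∫_{cX}^X E₃ ≥ e^γ (∫_{cX}^X E₂ − 2 log(1/c))`** for `2 ≤ cX ≤ X`, `c > 0` (`E₃ ≥ e^γ(E₂ − 2/x)` integrated).
[cite: Zhao2025MertensMean, §4 (first display) with Cor 1] -/
theorem integral_window_E₃_ge {c X : ℝ} (hc0 : 0 < c) (hcX : 2 ≤ c * X) (hc1 : c * X ≤ X) :
    Real.exp Real.eulerMascheroniConstant * ((∫ x in (c * X)..X, E₂ x) - 2 * Real.log c⁻¹) ≤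
      ∫ x in (c * X)..X, E₃ x := by
  have hX0 : 0 < X := by nlinarith
  have hcX0 : 0 < c * X := by positivity
  have hlog : ∫ x in (c * X)..X, 2 / x = 2 * Real.log c⁻¹ := by
    rw [show (fun x : ℝ => 2 / x) = fun x => 2 * x⁻¹ by funext x; rw [div_eq_mul_inv],
      intervalIntegral.integral_const_mul, integral_inv_of_pos hcX0 hX0,
      show X / (c * X) = c⁻¹ by field_simp]
  have hi2 : IntervalIntegrable (fun x : ℝ => 2 / x) volume (c * X) X := by
    refine (continuousOn_const.div continuousOn_id fun x hx => ?_).intervalIntegrable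
    rw [uIcc_of_le hc1] at hx
    exact (show (0 : ℝ) < x by linarith [hx.1]).ne'
  have hlow : ∫ x in (c * X)..X, Real.exp Real.eulerMascheroniConstant * (E₂ x - 2 / x) =
      Real.exp Real.eulerMascheroniConstant * ((∫ x in (c * X)..X, E₂ x) - 2 * Real.log c⁻¹) := by
    rw [intervalIntegral.integral_const_mul, intervalIntegral.integral_sub (intervalIntegrable_E₂ hcX hc1) hi2, hlog]
  rw [← hlow]
  exact intervalIntegral.integral_mono_on hc1
    (((intervalIntegrable_E₂ hcX hc1).sub hi2).const_mul _) (intervalIntegrable_E₃ hcX hc1)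
    fun x hx => E₃_ge (hcX.trans hx.1)

/-! ### Corollary 1 (`i = 3`) and the discharge -/

/-- **Zhao 2025, Corollary 1 for `i = 3`, PROVED** (filter form): under RH, for every `0 < c < ((2 − B₁)/(2 + B₁))²`,
`∫_{cX}^X E₃(x) dx > 0` for all large `X` (`B₁ = nicolasBeta`). [cite: Zhao2025MertensMean, Cor 1 (i = 3)] -/
theorem eventually_integral_window_E₃_pos_of_RH (hRH : RiemannHypothesis) {c : ℝ} (hc0 : 0 < c)
    (hc : c < ((2 - nicolasBeta) / (2 + nicolasBeta)) ^ 2) :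
    ∀ᶠ X : ℝ in atTop, 0 < ∫ x in (c * X)..X, E₃ x := by
  obtain ⟨κ, hκ, h⟩ := exists_eventually_le_integral_window_E₂_of_RH hRH hc0 hc
  have hβ0 : 0 < nicolasBeta := by linarith [nicolasBeta_gt]
  have hβ2 : nicolasBeta < 2 := by linarith [nicolasBeta_lt']
  have hq1 : (2 - nicolasBeta) / (2 + nicolasBeta) ≤ 1 := by
    rw [div_le_one (by linarith)]; linarith
  have hq0 : 0 ≤ (2 - nicolasBeta) / (2 + nicolasBeta) := div_nonneg (by linarith) (by linarith)
  have hc1 : c < 1 := lt_of_lt_of_le hc (by nlinarith)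
  set ℓ : ℝ := Real.log c⁻¹ with hℓ
  have hℓ0 : 0 ≤ ℓ := Real.log_nonneg ((one_le_inv₀ hc0).2 hc1.le)
  -- `κ √X / log X > 2ℓ` eventually: `√X ≥ (2ℓ + 1)/κ · log X`
  have hev : ∀ᶠ X : ℝ in atTop, 2 * ℓ < κ * Real.sqrt X / Real.log X := by
    filter_upwards [eventually_mul_log_le_mul_sqrt (by positivity : (0 : ℝ) ≤ (2 * ℓ + 1) / κ) one_pos,
      eventually_gt_atTop (1 : ℝ)] with X hX hX1
    have hL : 0 < Real.log X := Real.log_pos hX1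
    rw [lt_div_iff₀ hL, one_mul] at *
    have : (2 * ℓ + 1) / κ * Real.log X * κ = (2 * ℓ + 1) * Real.log X := by field_simp
    nlinarith [mul_le_mul_of_nonneg_right hX hκ.le]
  filter_upwards [h, hev, eventually_ge_atTop (2 / c)] with X hX hX2 hXc
  have hcX : 2 ≤ c * X := by rw [div_le_iff₀ hc0] at hXc; linarith
  have hX0 : 0 < X := by nlinarith
  have hcXX : c * X ≤ X := by nlinarith
  have h3 := integral_window_E₃_ge hc0 hcX hcXX
  have hpos : 0 < (∫ x in (c * X)..X, E₂ x) - 2 * Real.log c⁻¹ := by linarith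
  exact lt_of_lt_of_le (mul_pos (Real.exp_pos _) hpos) h3

/-- **Zhao 2025, Corollary 1 for `i = 3`, PROVED** in the shape of the named fact (third conjunct, `B₁ = 2 + γ − log 4π`).
[cite: Zhao2025MertensMean, Cor 1 (i = 3)] -/
theorem cor1_E₃_of_RH (hRH : RiemannHypothesis) {c : ℝ} (hc0 : 0 < c)
    (hc : c < ((2 - (2 + Real.eulerMascheroniConstant - Real.log (4 * π))) /
      (2 + (2 + Real.eulerMascheroniConstant - Real.log (4 * π)))) ^ 2) :
    ∃ X₀ : ℝ, ∀ X : ℝ, X₀ ≤ X → 0 < ∫ x in (c * X)..X, E₃ x := by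
  have hβ : nicolasBeta = 2 + Real.eulerMascheroniConstant - Real.log (4 * π) := by
    rw [nicolasBeta, show (4 : ℝ) * π = 2 ^ 2 * π by norm_num, Real.log_mul (by positivity) Real.pi_pos.ne',
      Real.log_pow]
    push_cast
    ring
  rw [← hβ] at hc
  exact (eventually_integral_window_E₃_pos_of_RH hRH hc0 hc).exists_forall_of_atTop

end Zhao2025

/-- **DISCHARGE of `Zhao2025MertensMean_cor1`** (Zhao 2025, Cor 1, all three cases, with the printed threshold
`c < ((2 − B₁)/(2 + B₁))²`, `B₁ = 2 + γ − log 4π`): assuming RH, `∫_{cX}^X E_i(x) dx > 0` for `i = 1, 2, 3` and all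
`X ≥ X₀(c)`. Assembled from `Zhao2025.eventually_integral_window_E₁_pos_of_RH` (Landau–Rosser–Schoenfeld tail bounds),
`Zhao2025.exists_eventually_le_integral_window_E₂_of_RH` (integration by parts against the `θ`-tail) and
`Zhao2025.eventually_integral_window_E₃_pos_of_RH` (`E₃ ≥ e^γ(E₂ − 2/x)`). [cite: Zhao2025MertensMean, Cor 1] -/
theorem Zhao2025MertensMean_cor1_holds : Zhao2025MertensMean_cor1 := by
  unfold Zhao2025MertensMean_cor1
  dsimp only
  intro hRH c hc0 hc
  have hβ : nicolasBeta = 2 + Real.eulerMascheroniConstant - Real.log (4 * π) := by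
    rw [nicolasBeta, show (4 : ℝ) * π = 2 ^ 2 * π by norm_num, Real.log_mul (by positivity) Real.pi_pos.ne',
      Real.log_pow]
    push_cast
    ring
  rw [← hβ] at hc
  have h1 := Zhao2025.eventually_integral_window_E₁_pos_of_RH hRH hc0 hc
  have h2 := Zhao2025.eventually_integral_window_E₂_pos_of_RH hRH hc0 hc
  have h3 := Zhao2025.eventually_integral_window_E₃_pos_of_RH hRH hc0 hc
  obtain ⟨X₀, hX₀⟩ := (h1.and (h2.and h3)).exists_forall_of_atTop
  exact ⟨X₀, hX₀⟩

end Literature.NumberTheory.LFunctions
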